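import Summits.ResolutionOfSingularities.ResolutionOfSingularities.Theorems.CleanCoversCoverResolutionSplit
import HarnessLib

/-!
# Crux `CleanCovers.CoverResolution` (stmt-ResolutionOfSingularities-15104), line `strategy-split`
# (v2): stub A4 `kedlayaLocalCover`

If a morphism `f : X → ℙⁿ_k` is étale over the chart `A = D₊(xₙ)` and, around every point `h`
off the chart, some open `B ∋ h` of `ℙⁿ_k` has resolvable preimage `f⁻¹(B)`, then every point of
`X` has a resolvable open neighbourhood. Over the chart: `f⁻¹(A)` is étale (hence smooth) over
the regular locally Noetherian scheme `A` (`smooth_isSeparated_quasiCompact_isRegular_opens_projectiveSpace`),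
hence regular (EGA IV₄ 17.5.8 (iii), `Scheme.IsRegular.of_smooth`), hence its own resolution
(`Scheme.IsRegular.hasResolution`). Off the chart: the hypothesis.
-/

set_option linter.dupNamespace false -- mandated namespace of this single-conjunct summit

namespace Summit.ResolutionOfSingularities.ResolutionOfSingularities.Theorems

open CategoryTheory AlgebraicGeometry TopologicalSpace
open Literature.AlgebraicGeometry.Resolution

/-- **Stub A4 `kedlayaLocalCover`** of the v2 split of `CoverResolution`: if `f : X → ℙⁿ_k` is
étale over the chart `D₊(xₙ)` and `f⁻¹(B)` is resolvable for some open `B ∋ h` around every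
point `h` off the chart, then every point of `X` has a resolvable open neighbourhood. Over the
chart, `f⁻¹(D₊(xₙ))` is étale over a regular locally Noetherian scheme, hence regular
(EGA IV₄ 17.5.8 (iii)), hence its own resolution; off the chart, the hypothesis applies at `f x`.
[folklore] -/
theorem stub_kedlayaLocalCover : ∀ (k : Type) [Field k] (n : ℕ) (X : AlgebraicGeometry.Scheme.{0}) (f : X ⟶ (Literature.AlgebraicGeometry.Motives.projectiveSpace n k).left), (letI := MvPolynomial.gradedAlgebra (σ := Fin (n + 1)) (R := k); AlgebraicGeometry.Etale (f ∣_ (AlgebraicGeometry.Proj.basicOpen (MvPolynomial.homogeneousSubmodule (Fin (n + 1)) k) (MvPolynomial.X (Fin.last n))))) → (∀ h : (Literature.AlgebraicGeometry.Motives.projectiveSpace n k).left, (letI := MvPolynomial.gradedAlgebra (σ := Fin (n + 1)) (R := k); h ∉ AlgebraicGeometry.Proj.basicOpen (MvPolynomial.homogeneousSubmodule (Fin (n + 1)) k) (MvPolynomial.X (Fin.last n))) → ∃ B : (Literature.AlgebraicGeometry.Motives.projectiveSpace n k).left.Opens, h ∈ B ∧ Literature.AlgebraicGeometry.Resolution.Scheme.HasResolution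 ((f ⁻¹ᵁ B : X.Opens) : AlgebraicGeometry.Scheme.{0})) → ∀ x : X, ∃ U : X.Opens, x ∈ U ∧ Literature.AlgebraicGeometry.Resolution.Scheme.HasResolution (U : AlgebraicGeometry.Scheme.{0}) := by
  intro k _ n X f het hL x
  letI := MvPolynomial.gradedAlgebra (σ := Fin (n + 1)) (R := k)
  -- the chart `A = D_+(x_n) ⊆ P^n_k`
  set A : (Literature.AlgebraicGeometry.Motives.projectiveSpace n k).left.Opens :=
    AlgebraicGeometry.Proj.basicOpen (MvPolynomial.homogeneousSubmodule (Fin (n + 1)) k)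
      (MvPolynomial.X (Fin.last n))
  haveI hAet : Etale (f ∣_ A) := het
  by_cases hx : f.base x ∈ A
  · -- over the chart: `f ⁻¹ A` is étale over the regular locally Noetherian `A`, hence regular
    haveI : IsProper (Literature.AlgebraicGeometry.Motives.projectiveSpace n k).hom :=
      Literature.AlgebraicGeometry.Motives.isProper_projectiveSpace n k
    haveI : IsLocallyNoetherian (Literature.AlgebraicGeometry.Motives.projectiveSpace n k).left :=
      LocallyOfFiniteType.isLocallyNoetherian
        (Literature.AlgebraicGeometry.Motives.projectiveSpace n k).hom
    have hAreg : Scheme.IsRegular (A : Scheme.{0}) :=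
      (smooth_isSeparated_quasiCompact_isRegular_opens_projectiveSpace n A).2.2.2
    have hfAreg : Scheme.IsRegular ((f ⁻¹ᵁ A : X.Opens) : Scheme.{0}) :=
      Scheme.IsRegular.of_smooth (f ∣_ A) hAreg
    exact ⟨f ⁻¹ᵁ A, hx, hfAreg.hasResolution⟩
  · -- off the chart: the hypothesis at `f x`
    obtain ⟨B, hB, hres⟩ := hL (f.base x) hx
    exact ⟨f ⁻¹ᵁ B, hB, hres⟩

end Summit.ResolutionOfSingularities.ResolutionOfSingularities.Theorems
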